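import Literature.NumberTheory.Automorphic.GL2SplitTorusOrbitalIntegral     -- ★ D-S1c-GL₂ (g2-i) `GL2.exists_orbitalIntegral_diagGL2_eq_smul_integral`
import Literature.NumberTheory.Automorphic.GLnConstantTermTestFunctions      -- ★ B1 §1 generic engine (tube lemma, averaging step), `nonarchimedeanGroup_gl`
import HarnessLib

/-!
# The split-torus orbital integral of `GL₂(F)` near the centre: the `K × N`-average `g ↦ ∫_{K×F} f(k g n(x) k⁻¹)` is invariant
# under a neighbourhood of `1`, hence `|D(γ)|^{1∕2} Φ(γ, f)` is CONSTANT for split-regular `γ` near a central `z` (`Γ_z^A = 0`)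

Topic `NumberTheory/Automorphic`; namespace `Literature.NumberTheory.Automorphic`.  THEOREMS ONLY (no definition, no named fact, no instance, no
notation, no `sorry`).  Cell `pub/hodgecm-mathlib`, F0∕P3a, road «D-S» (#88 (κ-loc) at a split place, SIZING-S1′ §2 row 3b), brick «GL₂ SPLIT-TORUS
LIMIT AT THE CENTRE» (LEAD F0P3a-plan (g9) WORD T8-3 (C); census F0P3a-p04 (g12) f3e6cfd4 §3 KL3).  HC_CM is proved only modulo the printed
citations until rung 0 closes; nothing printed is asserted here.

THE MATHEMATICS.  For `f ∈ C_c^∞(GL₂(F))` (locally constant, compact support) the normalised split-torus orbital integral is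
`|D(γ)|^{1∕2} Φ(γ, f) = const · ∫_K ∫_F f(k γ n(x) k⁻¹) dx dk` at `γ = d(m₀, m₁)`, `m₀ ≠ m₁` (★ D-S1c-GL₂ `GL2.exists_orbitalIntegral_diagGL2_eq_smul_integral`,
[Rogawski1990, §4.13 Lemma 4.13.1 (a)]; [Gelbart1975, Remark 9.23]).  The right-hand side makes sense for EVERY `g ∈ GL₂(F)` and, `f` being
left-invariant under a compact open subgroup `K₀` and `K` compact, it is invariant under LEFT TRANSLATION of `g` by a neighbourhood `V` of `1`
with `k V k⁻¹ ⊆ K₀` for all `k ∈ K` (★ B1's tube lemma and averaging step, [CartierCorvallis1979, §IV.1]).  Consequently, for a CENTRAL `z` and all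
split-regular `γ` with `γ z⁻¹ ∈ V`: `Φ(γ, f) = C ‖m₀⁻¹ m₁ − 1‖⁻¹ · ∫_{K×F} f(z · k n(x) k⁻¹)` — near the centre the split-torus orbital integral is
`|D|^{−1∕2}` times the unipotent average of `f` at `z`; in the language of Shalika germs on `GL₂` ([Rogawski1990, §8.1 p. 112, Prop. 8.1.1]:
`Φ(γ, f) = Σ_u Γ_u(γ) Λ_u(f)` near a singular point), the germ of the split torus at the TRIVIAL unipotent class vanishes (`Γ_z^A = 0`) and the
germ at the regular unipotent class is `|D(γ)|^{−1∕2}` — «the split torus alone does not see `f(z)`».  This is the split half of the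
central-germ input of (κ-loc) at a split place; the elliptic half (one elliptic torus DOES see `f(z)`) is floor 2 and not here.

* §1 (`GL_n(F)`, ANY kernel `q ↦ (k_q ∈ K, u_q)` on ANY measure space `(Q, ρ)`; upgrades ★ B1 §2.2, which is the `K × U_c` kernel):
  **`exists_nhds_one_forall_integral_conj_mul_left_eq`** (`∃ V ∈ 𝓝 1, ∀ t ∈ V, ∀ g, ∫ φ(k_q (t g u_q) k_q⁻¹) = ∫ φ(k_q (g u_q) k_q⁻¹)` — uniform
  translation invariance), `isLocallyConstant_integral_conj_kernel`, `eventually_integral_conj_kernel_eq`.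
* §2 (the D-S1c-GL₂ dress `Φ_f(g) := ∫_{K×F} f(k g n(x) k⁻¹) d(κ ⊗ dx)`, ★ (g2-i)'s right-hand side VERBATIM with `γ ↦ g`):
  **`GL2.exists_nhds_one_forall_splitTorusAverage_mul_eq`**, `GL2.isLocallyConstant_splitTorusAverage`, `GL2.splitTorusAverage_eq_of_mul_inv_mem`
  (`g g₀⁻¹ ∈ V ⇒ Φ_f g = Φ_f g₀`), `GL2.splitTorusAverage_diagGL2_eq_of_mul_inv_mem` (torus form), `GL2.splitTorusAverage_eq_of_forall_conj_eq`
  (`z` central: `Φ_f z = ∫ f(z · k n(x) k⁻¹)`, the unipotent average `Λ_z(f)`).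
* §3 the GERM READING: **`GL2.orbitalIntegral_diagGL2_eq_smul_central_average`** (BY-NAME inputs: ★ (g2-i)'s clause (2) as `hC`, §2's clause as `hV`)
  and the packaged **`GL2.exists_orbitalIntegral_diagGL2_eq_smul_central_average`** (★ (g2-i) ⊕ §2: ONE `C` with (g2-i)'s pin
  `C · κ(K) · dx(𝒪) = μ_q(π K)`, and for every `f ∈ C_c^∞` ONE `V ∈ 𝓝 1` with `Φ(γ, f) = C ‖m₀⁻¹m₁ − 1‖⁻¹ · Λ_z(f)` whenever `γ z⁻¹ ∈ V`, `z` central).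

## References
* [Rogawski1990] J. D. Rogawski, *Automorphic Representations of Unitary Groups in Three Variables*, Ann. of Math. Stud. 123 (1990), §4.13
  Lemma 4.13.1 (a) pp. 69–70 (split-torus descent); §8.1 p. 112, Prop. 8.1.1 (germ expansions near singular elements).
* [Gelbart1975] S. Gelbart, *Automorphic forms on adele groups* (1975), Thm. 9.22 (iii), Remark 9.23 p. 140 (`∫_{A∖G} = ∫_N ∫_K`).
* [CartierCorvallis1979] P. Cartier, *Representations of `p`-adic groups: a survey*, PSPM 33.1 (1979), §IV.1–IV.2 (uniform local constancy).
* [BernsteinZelevinsky1977] I. N. Bernstein, A. V. Zelevinsky, Ann. Sci. ÉNS 10 (1977), §2.3.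
-/

set_option autoImplicit false

noncomputable section

open MeasureTheory Measure Topology Filter
open scoped MatrixGroups NNReal ENNReal ValuativeRel

namespace Literature.NumberTheory.Automorphic

open Literature.NumberTheory.GaloisRepresentations.IsNonarchimedeanLocalField

/-! ## §1 `GL_n(F)`: the conjugation average over ANY kernel is invariant under a neighbourhood of `1` -/

section Kernel

variable (F : Type*) [Field F] [ValuativeRel F] [TopologicalSpace F] [IsNonarchimedeanLocalField F] {n : ℕ}
  {Q : Type*} [MeasurableSpace Q] (ρ : Measure Q) (kf : Q → ↥(glInt n F)) (uf : Q → GL (Fin n) F)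

/-- **Uniform translation invariance of the conjugation average** (any kernel): for `φ ∈ C_c^∞(GL_n(F))` (locally constant, compact support),
any measure space `(Q, ρ)` and any maps `k : Q → K = GL_n(𝒪)`, `u : Q → GL_n(F)`, there is `V ∈ 𝓝 1` with
`∫ φ(k_q (t g u_q) k_q⁻¹) dρ = ∫ φ(k_q (g u_q) k_q⁻¹) dρ` for all `t ∈ V` and ALL `g` — `φ` is left-invariant under a compact open `K₀` (★
`exists_isOpen_isCompact_forall_mul_eq_of_isLocallyConstant`), `k V k⁻¹ ⊆ K₀` for `k ∈ K` (★ `exists_open_nhds_one_forall_conj_mem`), and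
`k (t g u) k⁻¹ = (k t k⁻¹)(k (g u) k⁻¹)` (★ `integral_conj_mul_left_eq_of_forall`). [cite: CartierCorvallis1979, §IV.1–IV.2] [cite: BernsteinZelevinsky1977, §2.3] -/
theorem exists_nhds_one_forall_integral_conj_mul_left_eq {φ : GL (Fin n) F → ℂ} (hlc : IsLocallyConstant φ)
    (hcs : HasCompactSupport φ) :
    ∃ V ∈ 𝓝 (1 : GL (Fin n) F), ∀ t ∈ V, ∀ g : GL (Fin n) F,
      ∫ q, φ ((kf q : GL (Fin n) F) * (t * g * uf q) * (kf q : GL (Fin n) F)⁻¹) ∂ρ =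
        ∫ q, φ ((kf q : GL (Fin n) F) * (g * uf q) * (kf q : GL (Fin n) F)⁻¹) ∂ρ := by
  haveI : T2Space F := (isLocalField F).toT2Space
  haveI : LocallyCompactSpace F := (isLocalField F).toLocallyCompactSpace
  haveI : LocallyCompactSpace (Matrix (Fin n) (Fin n) F) := inferInstanceAs (LocallyCompactSpace (Fin n → Fin n → F))
  haveI : LocallyCompactSpace (GL (Fin n) F) := inferInstance
  haveI : NonarchimedeanGroup (GL (Fin n) F) := nonarchimedeanGroup_gl F n
  obtain ⟨K₀, hK₀o, -, hK₀⟩ := exists_isOpen_isCompact_forall_mul_eq_of_isLocallyConstant hlc hcs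
  obtain ⟨V, hVo, h1V, hV⟩ := exists_open_nhds_one_forall_conj_mem (isCompact_glInt n F) hK₀o K₀.one_mem
  refine ⟨V, hVo.mem_nhds h1V, fun t ht g => ?_⟩
  exact integral_conj_mul_left_eq_of_forall ρ (fun q => (kf q : GL (Fin n) F)) uf
    (fun w hw x => (hK₀ x w hw).2) (fun q => (kf q).2) (fun k hk => hV k hk t ht) g

/-- **The conjugation average over any kernel is locally constant on `GL_n(F)`** for `φ ∈ C_c^∞(GL_n(F))` (★ B1's `isLocallyConstant_constantTerm`
is the `K × U_c` kernel). [cite: CartierCorvallis1979, §IV.1–IV.2] [cite: BernsteinZelevinsky1977, §2.3] -/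
theorem isLocallyConstant_integral_conj_kernel {φ : GL (Fin n) F → ℂ} (hlc : IsLocallyConstant φ) (hcs : HasCompactSupport φ) :
    IsLocallyConstant fun g : GL (Fin n) F =>
      ∫ q, φ ((kf q : GL (Fin n) F) * (g * uf q) * (kf q : GL (Fin n) F)⁻¹) ∂ρ := by
  obtain ⟨V, hV, h⟩ := exists_nhds_one_forall_integral_conj_mul_left_eq F ρ kf uf hlc hcs
  exact isLocallyConstant_of_forall_nhds_one_mul hV fun t ht g => h t ht g

/-- Eventual form: near any `g₀`, the conjugation average of `φ ∈ C_c^∞(GL_n(F))` over any kernel equals its value at `g₀`.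
[cite: CartierCorvallis1979, §IV.1–IV.2] -/
theorem eventually_integral_conj_kernel_eq {φ : GL (Fin n) F → ℂ} (hlc : IsLocallyConstant φ) (hcs : HasCompactSupport φ)
    (g₀ : GL (Fin n) F) :
    ∀ᶠ g in 𝓝 g₀,
      ∫ q, φ ((kf q : GL (Fin n) F) * (g * uf q) * (kf q : GL (Fin n) F)⁻¹) ∂ρ =
        ∫ q, φ ((kf q : GL (Fin n) F) * (g₀ * uf q) * (kf q : GL (Fin n) F)⁻¹) ∂ρ :=
  (IsLocallyConstant.iff_eventually_eq _).1 (isLocallyConstant_integral_conj_kernel F ρ kf uf hlc hcs) g₀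

end Kernel

/-! ## §2 The D-S1c-GL₂ dress: `Φ_f(g) = ∫_{K×F} f(k g n(x) k⁻¹) d(κ ⊗ dx)` -/

section SplitTorusAverage

variable (F : Type*) [Field F] [ValuativeRel F] [TopologicalSpace F] [IsNonarchimedeanLocalField F]
  [MeasurableSpace F] [MeasurableSpace (GL (Fin 2) F)]
  (κ : Measure ↥(glInt 2 F)) (dx : Measure F)

/-- **The `K × N`-average of `f ∈ C_c^∞(GL₂(F))` is invariant under left translation by a neighbourhood of `1`**: there is `V ∈ 𝓝 1` with
`∫_{K×F} f(k (t g) n(x) k⁻¹) = ∫_{K×F} f(k g n(x) k⁻¹)` for all `t ∈ V` and all `g ∈ GL₂(F)` (§1 at the kernel `(k, x) ↦ (k, n(x))` on `K × F`,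
the right-hand side of ★ `GL2.exists_orbitalIntegral_diagGL2_eq_smul_integral` with `γ ↦ g`). [cite: Rogawski1990, §4.13 Lemma 4.13.1 (a) pp. 69–70] [cite: CartierCorvallis1979, §IV.1–IV.2] -/
theorem GL2.exists_nhds_one_forall_splitTorusAverage_mul_eq {f : GL (Fin 2) F → ℂ} (hlc : IsLocallyConstant f)
    (hcs : HasCompactSupport f) :
    ∃ V ∈ 𝓝 (1 : GL (Fin 2) F), ∀ t ∈ V, ∀ g : GL (Fin 2) F,
      ∫ p : ↥(glInt 2 F) × F, f ((p.1 : GL (Fin 2) F) * (t * g) *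
          ((unipotentGL2 p.2 : ↥(upperUnitriangular (Fin 2) F)) : GL (Fin 2) F) * (p.1 : GL (Fin 2) F)⁻¹) ∂(κ.prod dx) =
        ∫ p : ↥(glInt 2 F) × F, f ((p.1 : GL (Fin 2) F) * g *
          ((unipotentGL2 p.2 : ↥(upperUnitriangular (Fin 2) F)) : GL (Fin 2) F) * (p.1 : GL (Fin 2) F)⁻¹) ∂(κ.prod dx) := by
  obtain ⟨V, hV, h⟩ := exists_nhds_one_forall_integral_conj_mul_left_eq F (κ.prod dx) (fun p : ↥(glInt 2 F) × F => p.1)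
    (fun p : ↥(glInt 2 F) × F => ((unipotentGL2 p.2 : ↥(upperUnitriangular (Fin 2) F)) : GL (Fin 2) F)) hlc hcs
  refine ⟨V, hV, fun t ht g => ?_⟩
  have h' := h t ht g
  simp only [mul_assoc] at h' ⊢
  exact h'

/-- **`g ↦ ∫_{K×F} f(k g n(x) k⁻¹)` is locally constant on `GL₂(F)`** for `f ∈ C_c^∞(GL₂(F))`. [cite: Rogawski1990, §4.13 Lemma 4.13.1 (a) pp. 69–70] [cite: BernsteinZelevinsky1977, §2.3] -/
theorem GL2.isLocallyConstant_splitTorusAverage {f : GL (Fin 2) F → ℂ} (hlc : IsLocallyConstant f) (hcs : HasCompactSupport f) :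
    IsLocallyConstant fun g : GL (Fin 2) F =>
      ∫ p : ↥(glInt 2 F) × F, f ((p.1 : GL (Fin 2) F) * g *
        ((unipotentGL2 p.2 : ↥(upperUnitriangular (Fin 2) F)) : GL (Fin 2) F) * (p.1 : GL (Fin 2) F)⁻¹) ∂(κ.prod dx) := by
  obtain ⟨V, hV, h⟩ := GL2.exists_nhds_one_forall_splitTorusAverage_mul_eq F κ dx hlc hcs
  exact isLocallyConstant_of_forall_nhds_one_mul hV fun t ht g => h t ht g

variable {F κ dx} in
omit [TopologicalSpace F] [IsNonarchimedeanLocalField F] in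
/-- **`Φ_f(g) = Φ_f(g₀)` whenever `g g₀⁻¹ ∈ V`**, for the neighbourhood `V` of `GL2.exists_nhds_one_forall_splitTorusAverage_mul_eq` (taken as the
hypothesis `hV`, so that ONE `V = V_f` serves every base point). [cite: Rogawski1990, §4.13 Lemma 4.13.1 (a) pp. 69–70] [cite: CartierCorvallis1979, §IV.1–IV.2] -/
theorem GL2.splitTorusAverage_eq_of_mul_inv_mem {f : GL (Fin 2) F → ℂ} {V : Set (GL (Fin 2) F)}
    (hV : ∀ t ∈ V, ∀ g : GL (Fin 2) F,
      ∫ p : ↥(glInt 2 F) × F, f ((p.1 : GL (Fin 2) F) * (t * g) *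
          ((unipotentGL2 p.2 : ↥(upperUnitriangular (Fin 2) F)) : GL (Fin 2) F) * (p.1 : GL (Fin 2) F)⁻¹) ∂(κ.prod dx) =
        ∫ p : ↥(glInt 2 F) × F, f ((p.1 : GL (Fin 2) F) * g *
          ((unipotentGL2 p.2 : ↥(upperUnitriangular (Fin 2) F)) : GL (Fin 2) F) * (p.1 : GL (Fin 2) F)⁻¹) ∂(κ.prod dx))
    {g g₀ : GL (Fin 2) F} (hg : g * g₀⁻¹ ∈ V) :
    ∫ p : ↥(glInt 2 F) × F, f ((p.1 : GL (Fin 2) F) * g *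
        ((unipotentGL2 p.2 : ↥(upperUnitriangular (Fin 2) F)) : GL (Fin 2) F) * (p.1 : GL (Fin 2) F)⁻¹) ∂(κ.prod dx) =
      ∫ p : ↥(glInt 2 F) × F, f ((p.1 : GL (Fin 2) F) * g₀ *
        ((unipotentGL2 p.2 : ↥(upperUnitriangular (Fin 2) F)) : GL (Fin 2) F) * (p.1 : GL (Fin 2) F)⁻¹) ∂(κ.prod dx) := by
  have h := hV (g * g₀⁻¹) hg g₀
  rw [inv_mul_cancel_right] at h
  exact h

variable {F κ dx} in
omit [TopologicalSpace F] [IsNonarchimedeanLocalField F] in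
/-- **The torus form**: `Φ_f(d(m₀, m₁)) = Φ_f(d(a₀, a₁))` whenever `d(m₀, m₁) d(a₀, a₁)⁻¹ ∈ V` — in particular for all split-regular
`d(m₀, m₁)` near a central `d(z₀, z₀)` (no continuity of `diagGL2` is needed in this form). [cite: Rogawski1990, §4.13 Lemma 4.13.1 (a) pp. 69–70; §8.1 p. 112] -/
theorem GL2.splitTorusAverage_diagGL2_eq_of_mul_inv_mem {f : GL (Fin 2) F → ℂ} {V : Set (GL (Fin 2) F)}
    (hV : ∀ t ∈ V, ∀ g : GL (Fin 2) F,
      ∫ p : ↥(glInt 2 F) × F, f ((p.1 : GL (Fin 2) F) * (t * g) *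
          ((unipotentGL2 p.2 : ↥(upperUnitriangular (Fin 2) F)) : GL (Fin 2) F) * (p.1 : GL (Fin 2) F)⁻¹) ∂(κ.prod dx) =
        ∫ p : ↥(glInt 2 F) × F, f ((p.1 : GL (Fin 2) F) * g *
          ((unipotentGL2 p.2 : ↥(upperUnitriangular (Fin 2) F)) : GL (Fin 2) F) * (p.1 : GL (Fin 2) F)⁻¹) ∂(κ.prod dx))
    {m₀ m₁ a₀ a₁ : Fˣ} (hmem : diagGL2 m₀ m₁ * (diagGL2 a₀ a₁)⁻¹ ∈ V) :
    ∫ p : ↥(glInt 2 F) × F, f ((p.1 : GL (Fin 2) F) * diagGL2 m₀ m₁ *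
        ((unipotentGL2 p.2 : ↥(upperUnitriangular (Fin 2) F)) : GL (Fin 2) F) * (p.1 : GL (Fin 2) F)⁻¹) ∂(κ.prod dx) =
      ∫ p : ↥(glInt 2 F) × F, f ((p.1 : GL (Fin 2) F) * diagGL2 a₀ a₁ *
        ((unipotentGL2 p.2 : ↥(upperUnitriangular (Fin 2) F)) : GL (Fin 2) F) * (p.1 : GL (Fin 2) F)⁻¹) ∂(κ.prod dx) :=
  GL2.splitTorusAverage_eq_of_mul_inv_mem hV hmem

omit [TopologicalSpace F] [IsNonarchimedeanLocalField F] in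
/-- **At a central `z` the `K × N`-average is the unipotent average of `f` at `z`**: `∫_{K×F} f(k z n(x) k⁻¹) = ∫_{K×F} f(z · k n(x) k⁻¹)`
(`k z = z k`) — the functional `Λ_z(f)` of the regular unipotent germ. [cite: Rogawski1990, §8.1 p. 112] -/
theorem GL2.splitTorusAverage_eq_of_forall_conj_eq {E : Type*} [NormedAddCommGroup E] [NormedSpace ℝ E] {z : GL (Fin 2) F}
    (hz : ∀ y : GL (Fin 2) F, y * z * y⁻¹ = z) (f : GL (Fin 2) F → E) :
    ∫ p : ↥(glInt 2 F) × F, f ((p.1 : GL (Fin 2) F) * z *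
        ((unipotentGL2 p.2 : ↥(upperUnitriangular (Fin 2) F)) : GL (Fin 2) F) * (p.1 : GL (Fin 2) F)⁻¹) ∂(κ.prod dx) =
      ∫ p : ↥(glInt 2 F) × F, f (z * ((p.1 : GL (Fin 2) F) *
        ((unipotentGL2 p.2 : ↥(upperUnitriangular (Fin 2) F)) : GL (Fin 2) F) * (p.1 : GL (Fin 2) F)⁻¹)) ∂(κ.prod dx) := by
  refine integral_congr_ae (Eventually.of_forall fun p => ?_)
  have hk : (p.1 : GL (Fin 2) F) * z = z * (p.1 : GL (Fin 2) F) := mul_inv_eq_iff_eq_mul.1 (hz p.1)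
  show f _ = f _
  rw [hk]
  simp only [mul_assoc]

end SplitTorusAverage

/-! ## §3 The germ reading: near the centre `Φ(γ, f) = C ‖m₀⁻¹m₁ − 1‖⁻¹ · Λ_z(f)` -/

section Germ

variable {F : Type*} [Field F] [ValuativeRel F] [TopologicalSpace F] [IsNonarchimedeanLocalField F]
  [SecondCountableTopology F] [MeasurableSpace F] [BorelSpace F]
  [MeasurableSpace (GL (Fin 2) F)] [BorelSpace (GL (Fin 2) F)] [SecondCountableTopology (GL (Fin 2) F)]

omit [SecondCountableTopology F] [BorelSpace F] [BorelSpace (GL (Fin 2) F)] [SecondCountableTopology (GL (Fin 2) F)] in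
/-- **The split-torus orbital integral near the centre, BY-NAME inputs.**  Let `γ = d(m₀, m₁)` be split-regular, `μ_q` a measure on
`GL₂(F) ⧸ C(γ)` and `C` a constant with the (g2-i) identity `hC` (★ `GL2.exists_orbitalIntegral_diagGL2_eq_smul_integral`, clause (2)); let
`f ∈ C_c^∞` with the translation-invariance neighbourhood `V` of `GL2.exists_nhds_one_forall_splitTorusAverage_mul_eq` (`hV`); let `z` be central
with `γ z⁻¹ ∈ V`.  Then **`Φ(γ, f) = C ‖m₀⁻¹ m₁ − 1‖⁻¹ · ∫_{K×F} f(z · k n(x) k⁻¹)`**: the `|D|^{1∕2}`-normalised split orbital integral is CONSTANT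
near `z`, equal to the unipotent average of `f` at `z` (germ expansion of the split torus: `Γ_z^A = 0`, `Γ_u^A = |D|^{−1∕2}`).
[cite: Rogawski1990, §4.13 Lemma 4.13.1 (a) pp. 69–70; §8.1 p. 112, Prop. 8.1.1] -/
theorem GL2.orbitalIntegral_diagGL2_eq_smul_central_average {m₀ m₁ : Fˣ}
    [MeasurableSpace (GL (Fin 2) F ⧸ Subgroup.centralizer ({diagGL2 m₀ m₁} : Set (GL (Fin 2) F)))]
    (μq : Measure (GL (Fin 2) F ⧸ Subgroup.centralizer ({diagGL2 m₀ m₁} : Set (GL (Fin 2) F))))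
    (κ : Measure ↥(glInt 2 F)) (dx : Measure F) {C : ℝ≥0} {f : GL (Fin 2) F → ℂ}
    (hC : orbitalIntegral (diagGL2 m₀ m₁) f μq =
      ((C * (normAbs F (((m₀⁻¹ : Fˣ) : F) * m₁ - 1))⁻¹ : ℝ≥0) : ℝ) •
        ∫ p : ↥(glInt 2 F) × F, f ((p.1 : GL (Fin 2) F) * diagGL2 m₀ m₁ *
          ((unipotentGL2 p.2 : ↥(upperUnitriangular (Fin 2) F)) : GL (Fin 2) F) * (p.1 : GL (Fin 2) F)⁻¹) ∂(κ.prod dx))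
    {V : Set (GL (Fin 2) F)}
    (hV : ∀ t ∈ V, ∀ g : GL (Fin 2) F,
      ∫ p : ↥(glInt 2 F) × F, f ((p.1 : GL (Fin 2) F) * (t * g) *
          ((unipotentGL2 p.2 : ↥(upperUnitriangular (Fin 2) F)) : GL (Fin 2) F) * (p.1 : GL (Fin 2) F)⁻¹) ∂(κ.prod dx) =
        ∫ p : ↥(glInt 2 F) × F, f ((p.1 : GL (Fin 2) F) * g *
          ((unipotentGL2 p.2 : ↥(upperUnitriangular (Fin 2) F)) : GL (Fin 2) F) * (p.1 : GL (Fin 2) F)⁻¹) ∂(κ.prod dx))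
    {z : GL (Fin 2) F} (hz : ∀ y : GL (Fin 2) F, y * z * y⁻¹ = z) (hmem : diagGL2 m₀ m₁ * z⁻¹ ∈ V) :
    orbitalIntegral (diagGL2 m₀ m₁) f μq =
      ((C * (normAbs F (((m₀⁻¹ : Fˣ) : F) * m₁ - 1))⁻¹ : ℝ≥0) : ℝ) •
        ∫ p : ↥(glInt 2 F) × F, f (z * ((p.1 : GL (Fin 2) F) *
          ((unipotentGL2 p.2 : ↥(upperUnitriangular (Fin 2) F)) : GL (Fin 2) F) * (p.1 : GL (Fin 2) F)⁻¹)) ∂(κ.prod dx) := by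
  rw [hC, GL2.splitTorusAverage_eq_of_mul_inv_mem hV hmem, GL2.splitTorusAverage_eq_of_forall_conj_eq F κ dx hz f]

/-- **The split-torus orbital integral near the centre, packaged** (★ (g2-i) ⊕ §2).  For `γ = d(m₀, m₁)`, `m₀ ≠ m₁`, a non-zero invariant Radon
measure `μ_q` on `GL₂(F) ⧸ C(γ)`, a Haar measure `κ` on `K = GL₂(𝒪)` and an additive Haar measure `dx` on `F`: there is `C > 0` with (g2-i)'s pin
`C · κ(K) · dx(𝒪) = μ_q(π K)`, and for every `f ∈ C_c^∞(GL₂(F))` a neighbourhood `V ∈ 𝓝 1` such that for every CENTRAL `z` with `γ z⁻¹ ∈ V`,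
**`Φ(γ, f) = C ‖m₀⁻¹ m₁ − 1‖⁻¹ · ∫_{K×F} f(z · k n(x) k⁻¹) d(κ ⊗ dx)`**. [cite: Rogawski1990, §4.13 Lemma 4.13.1 (a) pp. 69–70; §8.1 p. 112, Prop. 8.1.1] [cite: Gelbart1975, Remark 9.23 p. 140] -/
theorem GL2.exists_orbitalIntegral_diagGL2_eq_smul_central_average {m₀ m₁ : Fˣ} (h : m₀ ≠ m₁)
    [MeasurableSpace (GL (Fin 2) F ⧸ Subgroup.centralizer ({diagGL2 m₀ m₁} : Set (GL (Fin 2) F)))]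
    [BorelSpace (GL (Fin 2) F ⧸ Subgroup.centralizer ({diagGL2 m₀ m₁} : Set (GL (Fin 2) F)))]
    (μq : Measure (GL (Fin 2) F ⧸ Subgroup.centralizer ({diagGL2 m₀ m₁} : Set (GL (Fin 2) F))))
    [SMulInvariantMeasure (GL (Fin 2) F) _ μq] [IsFiniteMeasureOnCompacts μq] (hμ : μq ≠ 0)
    (κ : Measure ↥(glInt 2 F)) [IsHaarMeasure κ] (dx : Measure F) [dx.IsAddHaarMeasure] :
    ∃ C : ℝ≥0, C ≠ 0 ∧
      (C : ℝ≥0∞) * (κ Set.univ * dx (𝒪[F] : Set F)) =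
        μq ((QuotientGroup.mk : GL (Fin 2) F → _) '' (glInt 2 F : Set (GL (Fin 2) F))) ∧
      ∀ f : GL (Fin 2) F → ℂ, IsLocallyConstant f → HasCompactSupport f →
        ∃ V ∈ 𝓝 (1 : GL (Fin 2) F), ∀ z : GL (Fin 2) F, (∀ y : GL (Fin 2) F, y * z * y⁻¹ = z) →
          diagGL2 m₀ m₁ * z⁻¹ ∈ V →
            orbitalIntegral (diagGL2 m₀ m₁) f μq =
              ((C * (normAbs F (((m₀⁻¹ : Fˣ) : F) * m₁ - 1))⁻¹ : ℝ≥0) : ℝ) •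
                ∫ p : ↥(glInt 2 F) × F, f (z * ((p.1 : GL (Fin 2) F) *
                  ((unipotentGL2 p.2 : ↥(upperUnitriangular (Fin 2) F)) : GL (Fin 2) F) * (p.1 : GL (Fin 2) F)⁻¹)) ∂(κ.prod dx) := by
  obtain ⟨C, hC0, hpin, hC⟩ := GL2.exists_orbitalIntegral_diagGL2_eq_smul_integral h μq hμ κ dx (E := ℂ)
  refine ⟨C, hC0, hpin, fun f hlc hcs => ?_⟩
  obtain ⟨V, hV1, hV⟩ := GL2.exists_nhds_one_forall_splitTorusAverage_mul_eq F κ dx hlc hcs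
  exact ⟨V, hV1, fun z hz hmem =>
    GL2.orbitalIntegral_diagGL2_eq_smul_central_average μq κ dx (hC f hlc.continuous hcs) hV hz hmem⟩

end Germ

end Literature.NumberTheory.Automorphic

end
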